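import Literature.MathematicalPhysics.QuantumLattice.FrozenEnvironmentCompression
import Literature.MathematicalPhysics.QuantumChemistry.KoopmansTheorem
import Literature.MathematicalPhysics.QuantumLattice.FreeFermionSpinTwistedTraceFormula
import HarnessLib

/-!
# The frozen-core (active-space) reduction of the molecular electronic Hamiltonian

Topic `Literature/MathematicalPhysics/QuantumChemistry`. An ACTIVE-SPACE MODEL of a molecule in a
finite orbital basis `Λ'` keeps a set of active orbitals (the image of an order embedding
`φ : Λ ↪o Λ'`), freezes a set `C ⊆ Λ'` of CORE orbitals as doubly occupied and deletes the remaining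
(virtual) orbitals; every wave function of the model is `|Φ_core Φ_active⟩` (Koridon et al. (2021)
App. A eq. (A1); Helgaker–Jørgensen–Olsen (2000) §12.5.1, inactive / active / secondary orbitals).
On the tree's Fock spaces this is the frozen-environment isometry
`V = frozenEmbed (orbEmb φ) (orbs C) : 𝔉(Orb Λ) → 𝔉(Orb Λ')` of
`QuantumLattice/FrozenEnvironmentEmbedding.lean` (environment configuration `K = orbs C`, the `2|C|`
core spin orbitals). This file PROVES, for the second-quantised spin-free Hamiltonian
`Ĥ(h, g, h_nuc) = Σ h_pq E_pq + ½ Σ g_pqrs e_pqrs + h_nuc` (`molecularHamiltonian`, HJO (2.2.18)) with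
ARBITRARY complex tables `h`, `g` on `Λ'`:

* `transSign_orbEmb_orbs`, `frozenEmbed_orbs_mulVec_apply`: in the orbital-major order `Λ ×ₗ Fin 2` the
  Jordan–Wigner sign of the core is `+1`, `(Vψ)(u') = [env u' = orbs C] · ψ(pre u')`;
* `isInSector_frozenEmbed_orbs_mulVec`: `V` maps the `(N_α, N_β) = (a, b)` sector into the
  `(a + |C|, b + |C|)` sector;
* `molecularHamiltonian_eq_sum_orb`: the spin-orbital integrals `h_{pσ,qτ} = δ_στ h_pq`,
  `g_{pσ,qτ,rμ,sν} = δ_στ δ_μν g_pqrs` (HJO (2.2.3), (2.2.10));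
* **`conjTranspose_frozenEmbed_mul_molecularHamiltonian_mul_frozenEmbed`** — THE FROZEN-CORE HAMILTONIAN:
  `Vᴴ Ĥ(h, g, h_nuc) V = Ĥ(h^FC, g|_act, h_nuc + E_core)` on `𝔉(Orb Λ)`, with
  `g|_act (x y z w) = g (φx)(φy)(φz)(φw)`,
  `h^FC_xy = h_{φx,φy} + Σ_{c∈C} (g_{φx,φy,c,c} + g_{c,c,φx,φy}) − ½ Σ_{c∈C} (g_{φx,c,c,φy} + g_{c,φy,φx,c})`,
  `E_core = 2 Σ_{c∈C} h_cc + Σ_{c,d∈C} (2 g_ccdd − g_cddc)` — the general-table form; under the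
  particle-exchange symmetry `(pq|rs) = (rs|pq)` (`…_of_symm`) `h^FC` is the INACTIVE FOCK MATRIX
  `ᴵF_xy = h_xy + Σ_c (2 g_xycc − g_xccy)` of HJO (12.5.12) restricted to the active orbitals (the
  `closedShellFock h g C` of `KoopmansTheorem.lean` at active arguments) and `E_core` is the inactive
  energy (12.5.16) = Koridon et al. (A3)–(A6) (`Ĥ^FC = Ĥ_act + E^MF_frozen + V̂`,
  `V_tu = Σ_i (2 g_tuii − g_tiiu)`, `E^MF = 2Σ_i h_ii + Σ_ij (2 g_iijj − g_ijji)`);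
* **`sectorGroundEnergy_le_frozenCore`**, `groundEnergy_le_frozenCore`: the frozen-core sector
  energies bound the sector energies of the full orbital-basis model FROM ABOVE,
  `E₀(Ĥ; a + |C|, b + |C|) ≤ E₀(Ĥ^FC; a, b)` and `E₀(Ĥ; N + 2|C|) ≤ E₀(Ĥ^FC; N)` (variation principle on
  the frozen-core wave functions; no table symmetry needed). The converse direction is FALSE in general
  (the active-space energy is not a lower bound for the full model): a certified LOWER bound for an
  active-space model says nothing about the full-basis model — the content of the honest framing
  "certified bounds for a STATED model Hamiltonian in a STATED basis".

Everything is PROVED (0 sorry, no definition, no named fact) from the generic compression theorems of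
`QuantumLattice/FrozenEnvironmentCompression.lean`; the proof of the main identity rewrites both
Hamiltonians in spin-orbital form, compresses, and compares the coefficient tables spin by spin
(`fin_cases` on `Fin 2`).

References: T. Helgaker, P. Jørgensen, J. Olsen, *Molecular Electronic-Structure Theory* (Wiley 2000),
§2.2.1 eqs. (2.2.2)–(2.2.3), (2.2.9)–(2.2.10), (2.2.12), (2.2.18); §12.5.1 eqs. (12.5.12), (12.5.16)
(held copy pp. 72–73, 718–719) [HelgakerJorgensenOlsen2000]; E. Koridon, S. Yalouz, B. Senjean, F. Buda,
T. E. O'Brien, L. Visscher, Phys. Rev. Research 3 (2021) 033127, App. A "Frozen core Hamiltonian" eqs.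
(A1)–(A6) (arXiv:2103.14753) [KoridonEtAl2021]; O. Bratteli, D. W. Robinson, *Operator Algebras and
Quantum Statistical Mechanics 2* (1997) §5.2.1 [BratteliRobinsonII1997].
-/

noncomputable section

namespace Literature.MathematicalPhysics.QuantumChemistry

open Matrix Finset Literature.MathematicalPhysics.QuantumLattice JWEmbed
open scoped ComplexOrder

variable {Λ Λ' : Type*} [LinearOrder Λ] [Fintype Λ] [LinearOrder Λ'] [Fintype Λ']
variable (φ : Λ ↪o Λ') {C : Finset Λ'}

/-! ### The core spin orbitals as a frozen environment of the active spin orbitals -/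

omit [Fintype Λ'] in
/-- The core spin orbitals lie outside the image of the active spin orbitals.
[cite: KoridonEtAl2021, App. A eq. (A1) (frozen / active / virtual partition)] -/
theorem disjoint_orbs_rangeF_orbEmb (hC : ∀ x, φ x ∉ C) : Disjoint (orbs C) (rangeF (orbEmb φ)) := by
  rw [Finset.disjoint_left]
  intro k hk hk'
  obtain ⟨i, rfl⟩ := mem_rangeF.1 hk'
  exact hC (ofLex i).1 (mem_orbs.1 hk)

omit [Fintype Λ'] in
/-- A spin orbital over a site outside the active range is an environment orbital.
[cite: KoridonEtAl2021, App. A eq. (A1) (frozen / active / virtual partition)] -/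
theorem orb_not_mem_rangeF_orbEmb {c : Λ'} (hc : ∀ x, φ x ≠ c) (σ : Fin 2) :
    orb c σ ∉ rangeF (orbEmb φ) := by
  intro h
  obtain ⟨i, hi⟩ := mem_rangeF.1 h
  exact hc (ofLex i).1 (orb_eq_orb_iff.1 hi).1

omit [Fintype Λ] [Fintype Λ'] in
/-- **The frozen-core Jordan–Wigner sign is trivial**: in the orbital-major order `Orb = Λ ×ₗ Fin 2` every
active spin orbital sees an EVEN number (both spins) of core spin orbitals below it, so
`transSign (orbEmb φ) (orbs C) X = 1`. [cite: HelgakerJorgensenOlsen2000, §12.5.1 (inactive orbitals doubly occupied)] -/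
theorem transSign_orbEmb_orbs (hC : ∀ x, φ x ∉ C) (X : Finset (Orb Λ)) :
    transSign (orbEmb φ) (orbs C) X = 1 := by
  refine Finset.prod_eq_one fun i _ => ?_
  have hfilter : (orbs C).filter (fun k => k < orbEmb φ i) =
      orbs (C.filter (fun c => c < φ (ofLex i).1)) := by
    ext k
    simp only [Finset.mem_filter, mem_orbs]
    constructor
    · rintro ⟨hkC, hlt⟩
      rcases Prod.Lex.lt_iff.1 hlt with hlt' | ⟨heq, -⟩
      · exact ⟨hkC, hlt'⟩
      · exact absurd hkC (heq ▸ hC (ofLex i).1)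
    · rintro ⟨hkC, hlt⟩
      exact ⟨hkC, Prod.Lex.lt_iff.2 (Or.inl hlt)⟩
  rw [envSign, hfilter, card_orbs, pow_mul]
  norm_num

omit [Fintype Λ'] in
/-- **The frozen-core embedding on vectors**, sign-free: `(V ψ)(u') = [env u' = orbs C] · ψ (pre u')` — the
wave function `|Φ_core Φ_active⟩`. [cite: KoridonEtAl2021, App. A eq. (A1)] -/
theorem frozenEmbed_orbs_mulVec_apply (hC : ∀ x, φ x ∉ C) (ψ : Fock (Orb Λ)) (u' : Finset (Orb Λ')) :
    (frozenEmbed (orbEmb φ) (orbs C) *ᵥ ψ) u' =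
      if env (orbEmb φ) u' = orbs C then ψ (pre (orbEmb φ) u') else 0 := by
  rw [frozenEmbed_mulVec_apply, transSign_orbEmb_orbs φ hC, one_mul]

/-! ### Sector transport: `(N_α, N_β) ↦ (N_α + |C|, N_β + |C|)` -/

omit [Fintype Λ] [Fintype Λ'] in
/-- Membership of a spin orbital of the big space in a recombined configuration `e u ∪ orbs C`.
[cite: KoridonEtAl2021, App. A eq. (A1)] -/
theorem orb_mem_combine_orbs_iff (u : Finset (Orb Λ)) (y : Λ') (s : Fin 2) :
    orb y s ∈ combine (orbEmb φ) u (orbs C) ↔ (∃ x, orb x s ∈ u ∧ φ x = y) ∨ y ∈ C := by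
  rw [mem_combine, orb_mem_orbs]
  constructor
  · rintro (⟨i, hi, hiy⟩ | hy)
    · obtain ⟨h1, h2⟩ := orb_eq_orb_iff.1 hiy
      refine Or.inl ⟨(ofLex i).1, ?_, h1⟩
      have : i = orb (ofLex i).1 s := by rw [← h2]; rfl
      rwa [← this]
    · exact Or.inr hy
  · rintro (⟨x, hx, rfl⟩ | hy)
    · exact Or.inl ⟨orb x s, hx, rfl⟩
    · exact Or.inr hy

/-- The spin-`s` occupied sites of `e u ∪ orbs C` are the images of those of `u` together with `C`.
[cite: KoridonEtAl2021, App. A eq. (A1)] -/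
theorem card_filter_orb_mem_combine_orbs [DecidableEq Λ'] (hC : ∀ x, φ x ∉ C) (u : Finset (Orb Λ))
    (s : Fin 2) :
    (Finset.univ.filter fun y : Λ' => orb y s ∈ combine (orbEmb φ) u (orbs C)).card =
      (Finset.univ.filter fun x : Λ => orb x s ∈ u).card + C.card := by
  have h : (Finset.univ.filter fun y : Λ' => orb y s ∈ combine (orbEmb φ) u (orbs C)) =
      (Finset.univ.filter fun x : Λ => orb x s ∈ u).map φ.toEmbedding ∪ C := by
    ext y
    simp only [Finset.mem_filter, Finset.mem_univ, true_and, Finset.mem_union, Finset.mem_map,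
      orb_mem_combine_orbs_iff]
    rfl
  rw [h, Finset.card_union_of_disjoint, Finset.card_map]
  refine Finset.disjoint_left.2 fun y hy hyC => ?_
  obtain ⟨x, -, rfl⟩ := Finset.mem_map.1 hy
  exact hC x hyC

/-- **Sector transport**: `V` maps the `(N_α, N_β) = (a, b)` sector of the active space into the
`(a + |C|, b + |C|)` sector of the full space (the core is doubly occupied).
[cite: KoridonEtAl2021, App. A eq. (A1) (frozen orbitals always occupied)] -/
theorem isInSector_frozenEmbed_orbs_mulVec (hC : ∀ x, φ x ∉ C) {a b : ℕ} {ψ : Fock (Orb Λ)}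
    (hψ : IsInSector a b ψ) :
    IsInSector (a + C.card) (b + C.card) (frozenEmbed (orbEmb φ) (orbs C) *ᵥ ψ) := by
  classical
  intro u' hu'
  rw [frozenEmbed_orbs_mulVec_apply φ hC]
  split_ifs with h
  · by_contra hne
    apply hu'
    have hsec : (upPart (pre (orbEmb φ) u')).card = a ∧ (downPart (pre (orbEmb φ) u')).card = b := by
      by_contra h'
      exact hne (hψ _ h')
    rw [← combine_pre_env (e := orbEmb φ) u', h, upPart, downPart,
      card_filter_orb_mem_combine_orbs φ hC, card_filter_orb_mem_combine_orbs φ hC, ← upPart, ← downPart,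
      hsec.1, hsec.2]
    exact ⟨rfl, rfl⟩
  · rfl

/-! ### The molecular Hamiltonian in spin-orbital form -/

omit [LinearOrder Λ'] [Fintype Λ'] in
/-- **The spin-orbital integrals of the spin-free Hamiltonian**: `h_{pσ,qτ} = δ_στ h_pq`,
`g_{pσ,qτ,rμ,sν} = δ_στ δ_μν g_pqrs`, i.e.
`Ĥ = Σ_{ij} [σ_i = σ_j] h_{p_i p_j} a†_i a_j + ½ Σ_{ijkl} [σ_i = σ_j][σ_k = σ_l] g_{p_i p_j p_k p_l} a†_i a†_k a_l a_j + h_nuc`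
summed over spin orbitals `i = (p_i, σ_i)`. Helgaker–Jørgensen–Olsen (2000) eqs. (2.2.2)–(2.2.3),
(2.2.9)–(2.2.10). [cite: HelgakerJorgensenOlsen2000, eqs. (2.2.3), (2.2.10)] -/
theorem molecularHamiltonian_eq_sum_orb (h : Λ → Λ → ℂ) (g : Λ → Λ → Λ → Λ → ℂ) (hnuc : ℂ) :
    molecularHamiltonian h g hnuc =
      ∑ i : Orb Λ, ∑ j : Orb Λ, (if (ofLex i).2 = (ofLex j).2 then h (ofLex i).1 (ofLex j).1 else 0) •
          (creation i * annihilation j) +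
        (1 / 2 : ℂ) • ∑ i : Orb Λ, ∑ j : Orb Λ, ∑ k : Orb Λ, ∑ l : Orb Λ,
          (if (ofLex i).2 = (ofLex j).2 ∧ (ofLex k).2 = (ofLex l).2 then
              g (ofLex i).1 (ofLex j).1 (ofLex k).1 (ofLex l).1 else 0) •
            (creation i * creation k * annihilation l * annihilation j) +
        hnuc • (1 : Matrix (Finset (Orb Λ)) (Finset (Orb Λ)) ℂ) := by
  rw [molecularHamiltonian_eq]
  congr 2
  · simp only [sum_orb_eq_sum_sum, ofLex_orb, ite_smul, zero_smul, Finset.sum_ite_eq, Finset.mem_univ,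
      if_true, Finset.smul_sum]
    exact Finset.sum_congr rfl fun p _ => Finset.sum_comm
  · congr 1
    simp only [sum_orb_eq_sum_sum, ofLex_orb, ite_smul, zero_smul, ite_and, Finset.sum_ite_irrel,
      Finset.sum_const_zero, Finset.sum_ite_eq, Finset.mem_univ, if_true, Finset.smul_sum]
    refine Finset.sum_congr rfl fun p _ => ?_
    conv_rhs => rw [Finset.sum_comm]
    refine Finset.sum_congr rfl fun q _ => ?_
    conv_rhs => rw [Finset.sum_comm]
    refine Finset.sum_congr rfl fun r _ => ?_
    conv_rhs => arg 2; ext σ; rw [Finset.sum_comm]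
    conv_rhs => rw [Finset.sum_comm]

omit [LinearOrder Λ] [Fintype Λ] [LinearOrder Λ'] [Fintype Λ'] in
/-- Sums over the spin orbitals of a set of sites. [cite: HelgakerJorgensenOlsen2000, eq. (2.2.3)] -/
theorem sum_orbs_eq_sum_sum {M : Type*} [AddCommMonoid M] (A : Finset Λ') (f : Orb Λ' → M) :
    ∑ k ∈ orbs A, f k = ∑ c ∈ A, ∑ σ : Fin 2, f (orb c σ) := by
  rw [orbs, Finset.sum_map, Finset.sum_product]
  rfl

/-! ### The frozen-core Hamiltonian -/

/-- **THE FROZEN-CORE (ACTIVE-SPACE) REDUCTION OF THE MOLECULAR HAMILTONIAN** (general complex tables):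
`Vᴴ Ĥ(h, g, h_nuc) V = Ĥ(h^FC, g|_act, h_nuc + E_core)` with
`h^FC_xy = h_{φx,φy} + Σ_{c∈C} (g_{φx,φy,c,c} + g_{c,c,φx,φy}) − ½ Σ_{c∈C} (g_{φx,c,c,φy} + g_{c,φy,φx,c})` and
`E_core = 2 Σ_c h_cc + Σ_{cd} (2 g_ccdd − g_cddc)`: the matrix elements of the full Hamiltonian between
frozen-core wave functions are those of the frozen-core Hamiltonian between their active parts,
`⟨Φ|Ĥ|Φ'⟩ = ⟨Φ_act|Ĥ^FC|Φ'_act⟩`. Koridon et al. (2021) App. A eqs. (A2)–(A6); Helgaker–Jørgensen–Olsen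
(2000) (12.5.12), (12.5.16) (printed for symmetric integrals, see `…_of_symm`).
[cite: KoridonEtAl2021, App. A eqs. (A2)-(A6)] -/
theorem conjTranspose_frozenEmbed_mul_molecularHamiltonian_mul_frozenEmbed (hC : ∀ x, φ x ∉ C)
    (h : Λ' → Λ' → ℂ) (g : Λ' → Λ' → Λ' → Λ' → ℂ) (hnuc : ℂ) :
    (frozenEmbed (orbEmb φ) (orbs C))ᴴ * molecularHamiltonian h g hnuc * frozenEmbed (orbEmb φ) (orbs C) =
      molecularHamiltonian
        (fun x y => h (φ x) (φ y) + ∑ c ∈ C, (g (φ x) (φ y) c c + g c c (φ x) (φ y)) -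
          (1 / 2 : ℂ) * ∑ c ∈ C, (g (φ x) c c (φ y) + g c (φ y) (φ x) c))
        (fun x y z w => g (φ x) (φ y) (φ z) (φ w))
        (hnuc + (2 * ∑ c ∈ C, h c c + ∑ c ∈ C, ∑ d ∈ C, (2 * g c c d d - g c d d c))) := by
  have hK := disjoint_orbs_rangeF_orbEmb φ hC
  rw [molecularHamiltonian_eq_sum_orb h g hnuc, Matrix.mul_add, Matrix.mul_add, Matrix.add_mul,
    Matrix.add_mul, Matrix.mul_smul, Matrix.smul_mul, Matrix.mul_smul, Matrix.smul_mul, Matrix.mul_one,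
    conjTranspose_frozenEmbed_mul_self _ hK,
    conjTranspose_frozenEmbed_mul_oneBody_mul_frozenEmbed _ hK,
    conjTranspose_frozenEmbed_mul_twoBody_mul_frozenEmbed _ hK, molecularHamiltonian_eq_sum_orb]
  simp only [sum_orb_eq_sum_sum, sum_orbs_eq_sum_sum, orbEmb_orb, ofLex_orb]
  -- the spin sums of the core contributions, per core orbital `c`
  have inner : ∀ (x : Λ) (σ : Fin 2) (y : Λ) (σ' : Fin 2) (c : Λ'),
      ∑ τ : Fin 2, ((((if σ = σ' ∧ True then g (φ x) (φ y) c c else 0) +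
          if True ∧ σ = σ' then g c c (φ x) (φ y) else 0) -
          if σ = τ ∧ τ = σ' then g (φ x) c c (φ y) else 0) -
          if τ = σ' ∧ σ = τ then g c (φ y) (φ x) c else 0) =
        if σ = σ' then 2 * (g (φ x) (φ y) c c + g c c (φ x) (φ y)) - (g (φ x) c c (φ y) + g c (φ y) (φ x) c)
        else 0 := by
    intro x σ y σ' c
    fin_cases σ <;> fin_cases σ' <;> simp [Fin.sum_univ_two] <;> ring
  have key1 : ∀ (x : Λ) (σ : Fin 2) (y : Λ) (σ' : Fin 2),
      (if σ = σ' then h (φ x) (φ y) + ∑ c ∈ C, (g (φ x) (φ y) c c + g c c (φ x) (φ y)) -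
          1 / 2 * ∑ c ∈ C, (g (φ x) c c (φ y) + g c (φ y) (φ x) c) else 0) =
        (if σ = σ' then h (φ x) (φ y) else 0) +
          (1 / 2 : ℂ) * ∑ c ∈ C, (if σ = σ' then
            2 * (g (φ x) (φ y) c c + g c c (φ x) (φ y)) - (g (φ x) c c (φ y) + g c (φ y) (φ x) c) else 0) := by
    intro x σ y σ'
    by_cases hs : σ = σ'
    · simp only [hs, if_true]
      rw [Finset.sum_sub_distrib, ← Finset.mul_sum]
      ring
    · simp [hs]
  have inner1 : ∀ c : Λ', ∑ σ : Fin 2, (if True then h c c else 0) = 2 * h c c := by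
    intro c
    simp [two_mul]
  have inner2 : ∀ c : Λ', ∑ σ : Fin 2, ∑ d ∈ C, ∑ τ : Fin 2,
      ((if True ∧ True then g c c d d else 0) - if σ = τ ∧ τ = σ then g c d d c else 0) =
        2 * ∑ d ∈ C, (2 * g c c d d - g c d d c) := by
    intro c
    rw [Finset.sum_comm, Finset.mul_sum]
    refine Finset.sum_congr rfl fun d _ => ?_
    simp [Fin.sum_univ_two]
    ring
  have half_two : ∀ X : ℂ, 1 / 2 * (2 * X) = X := by
    intro X
    ring
  simp only [inner, inner1, inner2, ← Finset.mul_sum]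
  simp only [key1]
  simp only [add_smul, Finset.sum_add_distrib, smul_add, Finset.smul_sum, smul_smul, half_two]
  abel

/-- **The printed form** under the particle-exchange symmetry `(pq|rs) = (rs|pq)` of the two-electron
integrals (always present, HJO (2.2.12)): the effective one-electron table is the INACTIVE (core) FOCK MATRIX
restricted to the active orbitals, `ᴵF_xy = h_xy + Σ_{c∈C} (2 g_xycc − g_xccy)` = the tree's
`closedShellFock h g C (φ x) (φ y)` (`KoopmansTheorem.lean`, HJO (10.3.24)), and the constant is
`h_nuc + ᴵE`, `ᴵE = Σ_{c∈C} (h_cc + ᴵF_cc) = 2 Σ_c h_cc + Σ_{cd} (2 g_ccdd − g_cddc)` (the inactive energy).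
Helgaker–Jørgensen–Olsen (2000) (12.5.12), (12.5.16); Koridon et al. (2021) (A3)–(A6).
[cite: HelgakerJorgensenOlsen2000, eqs. (12.5.12), (12.5.16)] -/
theorem conjTranspose_frozenEmbed_mul_molecularHamiltonian_mul_frozenEmbed_of_symm (hC : ∀ x, φ x ∉ C)
    (h : Λ' → Λ' → ℂ) {g : Λ' → Λ' → Λ' → Λ' → ℂ} (hg : ∀ p q r s, g p q r s = g r s p q) (hnuc : ℂ) :
    (frozenEmbed (orbEmb φ) (orbs C))ᴴ * molecularHamiltonian h g hnuc * frozenEmbed (orbEmb φ) (orbs C) =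
      molecularHamiltonian (fun x y => closedShellFock h g C (φ x) (φ y))
        (fun x y z w => g (φ x) (φ y) (φ z) (φ w))
        (hnuc + (2 * ∑ c ∈ C, h c c + ∑ c ∈ C, ∑ d ∈ C, (2 * g c c d d - g c d d c))) := by
  rw [conjTranspose_frozenEmbed_mul_molecularHamiltonian_mul_frozenEmbed φ hC]
  congr 1
  funext x y
  rw [closedShellFock_apply, add_sub_assoc, Finset.mul_sum, ← Finset.sum_sub_distrib]
  refine congrArg _ (Finset.sum_congr rfl fun c _ => ?_)
  rw [hg c c (φ x) (φ y), hg c (φ y) (φ x) c]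
  ring

/-! ### Frozen-core energies bound the full energies from above -/

/-- **The frozen-core (CAS) sector energies are UPPER bounds for the sector energies of the full
orbital-basis model**: `E₀(Ĥ(h, g, h_nuc); a + |C|, b + |C|) ≤ E₀(Ĥ^FC; a, b)` for every non-trivial
active sector `a, b ≤ |Λ|` (the variational principle on the frozen-core wave functions
`|Φ_core Φ_active⟩`, which span a subspace of the `(a + |C|, b + |C|)` sector). No symmetry of the
integral tables is needed. Helgaker–Jørgensen–Olsen (2000) §4.2.1 (variation principle) with §12.5.1;
Koridon et al. (2021) App. A (A2). [cite: KoridonEtAl2021, App. A eqs. (A2)-(A3)] -/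
theorem sectorGroundEnergy_le_frozenCore (hC : ∀ x, φ x ∉ C) (h : Λ' → Λ' → ℂ)
    (g : Λ' → Λ' → Λ' → Λ' → ℂ) (hnuc : ℂ) {a b : ℕ} (ha : a ≤ Fintype.card Λ) (hb : b ≤ Fintype.card Λ) :
    sectorGroundEnergy (molecularHamiltonian h g hnuc) (a + C.card) (b + C.card) ≤
      sectorGroundEnergy (molecularHamiltonian
        (fun x y => h (φ x) (φ y) + ∑ c ∈ C, (g (φ x) (φ y) c c + g c c (φ x) (φ y)) -
          (1 / 2 : ℂ) * ∑ c ∈ C, (g (φ x) c c (φ y) + g c (φ y) (φ x) c))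
        (fun x y z w => g (φ x) (φ y) (φ z) (φ w))
        (hnuc + (2 * ∑ c ∈ C, h c c + ∑ c ∈ C, ∑ d ∈ C, (2 * g c c d d - g c d d c)))) a b := by
  have hK := disjoint_orbs_rangeF_orbEmb φ hC
  rw [sectorGroundEnergy_def, sectorGroundEnergy_def, Matrix.minEnergyOn, Matrix.minEnergyOn]
  refine le_csInf ?_ ?_
  · obtain ⟨ψ, hψmem, hψ0⟩ := (Submodule.ne_bot_iff _).1 (szSector_upDown_ne_bot ha hb)
    obtain ⟨c, -, hc1⟩ := exists_smul_unit hψ0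
    exact ⟨_, c • ψ, Submodule.smul_mem _ c hψmem, hc1, rfl⟩
  · rintro E ⟨ψ, hψ, hψ1, rfl⟩
    refine csInf_le ⟨-(∑ s, ∑ t, ‖molecularHamiltonian h g hnuc s t‖), ?_⟩
      ⟨frozenEmbed (orbEmb φ) (orbs C) *ᵥ ψ, ?_, ?_, ?_⟩
    · rintro E' ⟨u, -, hu1, rfl⟩
      exact neg_sum_norm_le_re_expect _ hu1
    · exact (mem_szSector_iff_isInSector _ _ _).2
        (isInSector_frozenEmbed_orbs_mulVec φ hC ((mem_szSector_iff_isInSector a b ψ).1 hψ))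
    · rw [star_frozenEmbed_mulVec_dotProduct _ hK, hψ1]
    · rw [star_mulVec, ← dotProduct_mulVec, mulVec_mulVec, mulVec_mulVec,
        conjTranspose_frozenEmbed_mul_molecularHamiltonian_mul_frozenEmbed φ hC]

/-- **The same for the `N`-electron sector energies** (`N ↦ N + 2|C|`: the core carries two electrons per
orbital): `E₀(Ĥ; N + 2|C|) ≤ E₀(Ĥ^FC; N)` for `N ≤ 2|Λ|`. [cite: KoridonEtAl2021, App. A eqs. (A2)-(A3)] -/
theorem groundEnergy_le_frozenCore (hC : ∀ x, φ x ∉ C) (h : Λ' → Λ' → ℂ) (g : Λ' → Λ' → Λ' → Λ' → ℂ)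
    (hnuc : ℂ) {N : ℕ} (hN : N ≤ Fintype.card (Orb Λ)) :
    QuantumLattice.groundEnergy (molecularHamiltonian h g hnuc) (N + 2 * C.card) ≤
      QuantumLattice.groundEnergy (molecularHamiltonian
        (fun x y => h (φ x) (φ y) + ∑ c ∈ C, (g (φ x) (φ y) c c + g c c (φ x) (φ y)) -
          (1 / 2 : ℂ) * ∑ c ∈ C, (g (φ x) c c (φ y) + g c (φ y) (φ x) c))
        (fun x y z w => g (φ x) (φ y) (φ z) (φ w))
        (hnuc + (2 * ∑ c ∈ C, h c c + ∑ c ∈ C, ∑ d ∈ C, (2 * g c c d d - g c d d c)))) N := by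
  have hK := disjoint_orbs_rangeF_orbEmb φ hC
  unfold QuantumLattice.groundEnergy
  refine le_csInf ?_ ?_
  · -- the active `N`-particle sector contains a unit occupation-basis vector
    obtain ⟨s, -, hs⟩ := Finset.exists_subset_card_eq
      (show N ≤ (Finset.univ : Finset (Orb Λ)).card by rwa [Finset.card_univ])
    refine ⟨_, Pi.single s 1, fun t ht => ?_, ?_, rfl⟩
    · rw [Pi.single_apply, if_neg]
      rintro rfl
      exact ht hs
    · rw [dotProduct_single, Pi.star_apply, Pi.single_eq_same, star_one, one_mul]
  · rintro E ⟨ψ, hψ, hψ1, rfl⟩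
    refine csInf_le ⟨-(∑ s, ∑ t, ‖molecularHamiltonian h g hnuc s t‖), ?_⟩
      ⟨frozenEmbed (orbEmb φ) (orbs C) *ᵥ ψ, ?_, ?_, ?_⟩
    · rintro E' ⟨u, -, hu1, rfl⟩
      exact neg_sum_norm_le_re_expect _ hu1
    · rw [← card_orbs]
      exact isNParticle_frozenEmbed_mulVec _ hK hψ
    · rw [star_frozenEmbed_mulVec_dotProduct _ hK, hψ1]
    · unfold QuantumLattice.expect
      rw [star_mulVec, ← dotProduct_mulVec, mulVec_mulVec, mulVec_mulVec,
        conjTranspose_frozenEmbed_mul_molecularHamiltonian_mul_frozenEmbed φ hC]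

end Literature.MathematicalPhysics.QuantumChemistry

end
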